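import Summits.RiemannHypothesis.RiemannHypothesis.Theorems.MotivicDoorFfBaseChange
import Summits.RiemannHypothesis.RiemannHypothesis.Theorems.MotivicDoorFfSparseThreshold
import Summits.RiemannHypothesis.RiemannHypothesis.Theorems.MotivicDoorFfResidueLags

/-!
# Motivic door, function-field side (C)(i), part 8a: STRIDES — the point counts over `𝔽_{q^N}, …, 𝔽_{q^{gN}}`
decide RH at dimension `g`
(pub-rhdoor seat ff-1.  HONEST FRAMING: lottery ticket at the motivic door; RH probability negligible; consolation
prizes are real: a new semi-local Weil-positivity theorem, or a located gap in the Connes–Consani programme, plus the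
ff-door theorem.  No claim about `ζ`; "RH(q,h)" is `|α| = √q` for the complex roots of ONE integer polynomial `h`.)

Parts 7b/7c located the deciding lag sets INSIDE `[0, g]` (exactly the supersets of `{1, …, g}`,
`traceReader_decides_iff`) and a necessary condition for arbitrary lag sets (a non-zero multiple of every `N ≤ g`
dividing `2g`, `decidingLags_contain_multiples`).  PROVED here, all [folklore]:

* §1 HANDOVER FOR `Q`-SYMMETRIC MULTISETS: a multiset `A ⊂ ℂ` of size `2g`, closed under `a ↦ Q/a` WITH
  multiplicities and with `∏ A = Q^g` (`Q ≠ 0`), satisfies the reflection `e_{2g-k}(A) = Q^{g-k} e_k(A)` (`k ≤ g`,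
  `esymm_reflect_of_map_div`) and is therefore PINNED by its power sums `s_1, …, s_g` (`eq_of_powerSum_eq_of_map_div`).
* §2 the base-changed datum `A^N = {α^N}` of an honest datum of dimension `g` is `q^N`-symmetric of size `2g` with
  `∏ A^N = (q^N)^g` (`map_pow_frobRoots_symmetric`), and `s_n(A^N) = s_{Nn}(A)` (part 6, `powerSum_map_pow`).
* §3 STRIDES DECIDE (`map_pow_frobRoots_eq_of_strideTraces_eq`, `ffRH_iff_of_strideTraces_eq`,
  `exists_strideTraceReader_deciding`): for `q ≥ 1`, `N ≥ 1` and EVERY `g`, the traces `K(N), K(2N), …, K(gN)` — the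
  point counts over `𝔽_{q^N}, …, 𝔽_{q^{gN}}` — of an honest datum of dimension `g` determine the multiset `{α^N}`,
  hence DECIDE RH at dimension `g`: there is an `{N, 2N, …, gN}`-trace-local reader deciding RH at dimension `g`.
  (They do NOT pin the datum: `x^2 + x + q` and `x^2 - x + q` share `s_2 = 1 - 2q`.)  EXACT PROGRESSION THRESHOLD
  (`strideTraceReader_decides_iff`): for `q ≥ 2` and `gcd(N, g) = 1`, a reader of the traces at `N, 2N, …, dN`
  deciding RH on the honest data of dimension `g` EXISTS IF AND ONLY IF `d ≥ g` (⇒ by part 7c: for `d < g` the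
  progression contains no multiple of `g`).  `N = 1` is part 7b's threshold.

DOOR READING ((i).G, information level): deciding RH at dimension `g` takes `g` WELL-PLACED traces, and `g` traces
suffice in infinitely many positions — every progression `{N, …, gN}`; which lag sets decide is governed by
divisibility (part 7c), not by depth or density.  Nothing here is, or implies, a statement about `ζ`.

CONTEXT (cited, not used): §1–§3 are the multiset form of [Stichtenoth, *Algebraic function fields and codes* (1993),
Cor. V.1.17, p. 167: "given `N_1, …, N_g` we can determine `L(t)` from (5.17) and `a_{2g-i} = q^{g-i} a_i`";
Thm V.1.15(f), p. 165: `L_r(t) = ∏ (1 - α_i^r t)` for the constant field extension of degree `r`; Lemma V.2.4, p. 169: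
Hasse–Weil holds for `F` iff it holds for a constant field extension; 2nd ed. = bib `Stichtenoth2009`], applied to ONE
integer polynomial with the coefficient FE instead of a function field; the proofs below are self-contained.
-/

set_option linter.dupNamespace false

noncomputable section

open Polynomial Finset

open Summit.RiemannHypothesis.RiemannHypothesis.Theorems.PfPersistence.FfAngleTwin

namespace Summit.RiemannHypothesis.RiemannHypothesis.Theorems.MotivicDoor.FunctionField

/-! ## 1. Handover for `Q`-symmetric multisets -/

/-- `e_{j+1}(a :: s) = e_{j+1}(s) + a e_j(s)`. [folklore] -/
private theorem esymm_cons_succ_aux (a : ℂ) (s : Multiset ℂ) (j : ℕ) :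
    (a ::ₘ s).esymm (j + 1) = s.esymm (j + 1) + a * s.esymm j := by
  simp only [Multiset.esymm, Multiset.powersetCard_cons, Multiset.map_add, Multiset.sum_add,
    Multiset.map_map, Function.comp_def, Multiset.prod_cons]
  rw [← Multiset.sum_map_mul_left]

/-- `e_{#s}(s) = ∏ s`. [folklore] -/
private theorem esymm_card_eq_prod_aux (s : Multiset ℂ) : s.esymm (Multiset.card s) = s.prod := by
  rw [Multiset.esymm, Multiset.powersetCard_self, Multiset.map_singleton, Multiset.sum_singleton]

/-- `e_j(s⁻¹) · ∏ s = e_l(s)` for `j + l = #s`, `0 ∉ s` — the coefficients of the reciprocal polynomial (the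
statement of `Literature…LanglandsTetrahedralProofs.esymm_map_inv_mul_prod`, re-proved privately to keep the import
cone small). [folklore] -/
private theorem esymm_map_inv_mul_prod_aux (s : Multiset ℂ) (hs : ∀ a ∈ s, a ≠ 0) {j l : ℕ}
    (hjl : j + l = Multiset.card s) :
    (s.map (·⁻¹)).esymm j * s.prod = s.esymm l := by
  induction s using Multiset.induction_on generalizing j l with
  | empty =>
    rw [Multiset.card_zero, Nat.add_eq_zero_iff] at hjl
    obtain ⟨rfl, rfl⟩ := hjl
    simp [Multiset.esymm]
  | cons a s ih =>
    have ha : a ≠ 0 := hs a (Multiset.mem_cons_self a s)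
    have hs' : ∀ b ∈ s, b ≠ 0 := fun b hb => hs b (Multiset.mem_cons_of_mem hb)
    have hzero : ∀ (t : Multiset ℂ) (i : ℕ), Multiset.card t < i → t.esymm i = 0 := fun t i h => by
      simp [Multiset.esymm, Multiset.powersetCard_eq_empty _ h]
    have hzero' : ∀ t : Multiset ℂ, t.esymm 0 = 1 := fun t => by simp [Multiset.esymm]
    rw [Multiset.card_cons] at hjl
    simp only [Multiset.map_cons, Multiset.prod_cons]
    rcases j with _ | j
    · have hl : l = Multiset.card (a ::ₘ s) := by rw [Multiset.card_cons]; omega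
      rw [hzero', one_mul, hl, esymm_card_eq_prod_aux, Multiset.prod_cons]
    rcases l with _ | l
    · have h0 : (s.map (·⁻¹)).esymm (j + 1) = 0 := hzero _ _ (by rw [Multiset.card_map]; omega)
      have h1 := ih hs' (j := j) (l := 0) (by omega)
      rw [hzero'] at h1
      rw [esymm_cons_succ_aux, h0, zero_add, hzero']
      calc a⁻¹ * (s.map (·⁻¹)).esymm j * (a * s.prod)
          = (a⁻¹ * a) * ((s.map (·⁻¹)).esymm j * s.prod) := by ring
        _ = 1 := by rw [inv_mul_cancel₀ ha, one_mul, h1]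
    · have h1 := ih hs' (j := j + 1) (l := l) (by omega)
      have h2 := ih hs' (j := j) (l := l + 1) (by omega)
      rw [esymm_cons_succ_aux, esymm_cons_succ_aux]
      calc ((s.map (·⁻¹)).esymm (j + 1) + a⁻¹ * (s.map (·⁻¹)).esymm j) * (a * s.prod)
          = a * ((s.map (·⁻¹)).esymm (j + 1) * s.prod)
            + (a⁻¹ * a) * ((s.map (·⁻¹)).esymm j * s.prod) := by ring
        _ = s.esymm (l + 1) + a * s.esymm l := by
          rw [h1, h2, inv_mul_cancel₀ ha, one_mul, add_comm]

/-- REFLECTION for a `Q`-SYMMETRIC MULTISET: if `A` has size `2g`, is closed under `a ↦ Q/a` with multiplicities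
and `∏ A = Q^g` (`Q ≠ 0`), then `e_{2g-k}(A) = Q^{g-k} e_k(A)` for `k ≤ g` (`A = Q · A⁻¹`, so
`e_k(A) = Q^k e_k(A⁻¹)`, and `e_k(A⁻¹) ∏ A = e_{2g-k}(A)`).  For `A = frobRoots h` this is the coefficient FE.
[folklore] -/
theorem esymm_reflect_of_map_div {A : Multiset ℂ} {Q : ℂ} (hQ : Q ≠ 0) {g : ℕ}
    (hcard : Multiset.card A = 2 * g) (hsymm : A.map (fun a => Q / a) = A) (hprod : A.prod = Q ^ g)
    {k : ℕ} (hk : k ≤ g) : A.esymm (2 * g - k) = Q ^ (g - k) * A.esymm k := by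
  have h0 : ∀ a ∈ A, a ≠ 0 := by
    intro a ha ha0
    have h := Multiset.prod_eq_zero (ha0 ▸ ha)
    rw [hprod] at h
    exact pow_ne_zero g hQ h
  have hek : Q ^ k * (A.map (·⁻¹)).esymm k = A.esymm k := by
    have h := Multiset.pow_smul_esymm Q k (A.map (·⁻¹))
    simp only [smul_eq_mul, Multiset.map_map, Function.comp_def] at h
    have hA : (A.map fun a => Q * a⁻¹) = A := by
      conv_rhs => rw [← hsymm]
      exact Multiset.map_congr rfl fun a _ => by rw [div_eq_mul_inv]
    rw [h, hA]
  have hinv := esymm_map_inv_mul_prod_aux A h0 (j := k) (l := 2 * g - k) (by rw [hcard]; omega)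
  rw [← hinv, ← hek, hprod, ← mul_assoc, ← pow_add, Nat.sub_add_cancel hk]
  ring

/-- HANDOVER FOR `Q`-SYMMETRIC MULTISETS: two `Q`-symmetric multisets of size `2g` with product `Q^g` (`Q ≠ 0`) and
the same power sums `s_1, …, s_g` are EQUAL (Newton `s ↦ e` up to `g`, reflection above `g`, Vieta). [folklore] -/
theorem eq_of_powerSum_eq_of_map_div {A B : Multiset ℂ} {Q : ℂ} (hQ : Q ≠ 0) {g : ℕ}
    (hcA : Multiset.card A = 2 * g) (hcB : Multiset.card B = 2 * g)
    (hsA : A.map (fun a => Q / a) = A) (hsB : B.map (fun a => Q / a) = B)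
    (hpA : A.prod = Q ^ g) (hpB : B.prod = Q ^ g)
    (hs : ∀ n, 1 ≤ n → n ≤ g → powerSum A n = powerSum B n) : A = B := by
  have he : ∀ k, k ≤ g → A.esymm k = B.esymm k := esymm_eq_of_powerSum_eq hs
  have he' : ∀ j, j ≤ 2 * g → A.esymm j = B.esymm j := by
    intro j hj
    by_cases hjg : j ≤ g
    · exact he j hjg
    · obtain ⟨k, hk, rfl⟩ : ∃ k, k ≤ g ∧ j = 2 * g - k := ⟨2 * g - j, by omega, by omega⟩
      rw [esymm_reflect_of_map_div hQ hcA hsA hpA hk, esymm_reflect_of_map_div hQ hcB hsB hpB hk, he k hk]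
  have hpp : (A.map fun a => X - C a).prod = (B.map fun a => X - C a).prod := by
    rw [Multiset.prod_X_sub_X_eq_sum_esymm, Multiset.prod_X_sub_X_eq_sum_esymm, hcA, hcB]
    refine sum_congr rfl fun j hj => ?_
    rw [mem_range] at hj
    rw [he' j (by omega)]
  have h := congrArg Polynomial.roots hpp
  simpa only [Polynomial.roots_multiset_prod_X_sub_C] using h

/-! ## 2. The base-changed datum `{α^N}` of an honest datum is `q^N`-symmetric -/

/-- `∏ frobRoots h = q^g` for an honest datum of dimension `g` (`c_0 = q^g` by the FE; Vieta). [folklore] -/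
theorem prod_frobRoots_eq {q : ℕ} (hq : 0 < q) {h : ℤ[X]} {g : ℕ} (hh : h.Monic) (hdeg : h.natDegree = 2 * g)
    (hFE : ∀ i j, i + j = 2 * g → (q : ℤ) ^ g * h.coeff j = (q : ℤ) ^ i * h.coeff i) :
    (frobRoots h).prod = (q : ℂ) ^ g := by
  have hc0 : h.coeff 0 = (q : ℤ) ^ g := ((fe_iff_map_reciprocal_and_coeff_zero hq hh hdeg).1 hFE).2
  have e := cast_coeff_sub_eq_esymm hh (k := 2 * g) (by rw [hdeg])
  rw [hdeg, Nat.sub_self, hc0, pow_mul, neg_one_sq, one_pow, one_mul, ← hdeg, ← card_frobRoots hh,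
    esymm_card_eq_prod_aux] at e
  exact_mod_cast e.symm

/-- THE BASE-CHANGED DATUM `A^N = {α^N : α ∈ frobRoots h}` of an honest datum of dimension `g` (`q ≥ 1`): size `2g`,
closed under `a ↦ q^N / a` with multiplicities, product `(q^N)^g`.  (Its power sums are `s_n(A^N) = s_{Nn}(h)`,
part 6 `powerSum_map_pow`.) [folklore] -/
theorem map_pow_frobRoots_symmetric {q : ℕ} (hq : 0 < q) {h : ℤ[X]} {g : ℕ} (hh : h.Monic)
    (hdeg : h.natDegree = 2 * g)
    (hFE : ∀ i j, i + j = 2 * g → (q : ℤ) ^ g * h.coeff j = (q : ℤ) ^ i * h.coeff i) (N : ℕ) :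
    Multiset.card ((frobRoots h).map (· ^ N)) = 2 * g ∧
    ((frobRoots h).map (· ^ N)).map (fun a => (q : ℂ) ^ N / a) = (frobRoots h).map (· ^ N) ∧
    ((frobRoots h).map (· ^ N)).prod = ((q : ℂ) ^ N) ^ g := by
  refine ⟨by rw [Multiset.card_map, card_frobRoots hh, hdeg], ?_, ?_⟩
  · conv_rhs => rw [← frobRoots_map_reciprocal hq hdeg hFE]
    simp only [Multiset.map_map, Function.comp_def, div_pow]
  · rw [Multiset.prod_map_pow, Multiset.map_id', prod_frobRoots_eq hq hh hdeg hFE]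
    ring

/-! ## 3. Strides decide RH at dimension `g`; the exact progression threshold -/

/-- STRIDE TRACES HAND OVER THE BASE-CHANGED DATUM: two honest data `h, f` of dimension `g` (`q ≥ 1`) with
`s_{Nn}(h) = s_{Nn}(f)` for `n = 1, …, g` have the same multiset `{α^N}`. [folklore] -/
theorem map_pow_frobRoots_eq_of_strideTraces_eq {q : ℕ} (hq : 0 < q) {g N : ℕ} {h f : ℤ[X]}
    (hh : h.Monic) (hdeg : h.natDegree = 2 * g)
    (hFE : ∀ i j, i + j = 2 * g → (q : ℤ) ^ g * h.coeff j = (q : ℤ) ^ i * h.coeff i)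
    (hf : f.Monic) (hdegf : f.natDegree = 2 * g)
    (hFEf : ∀ i j, i + j = 2 * g → (q : ℤ) ^ g * f.coeff j = (q : ℤ) ^ i * f.coeff i)
    (hs : ∀ n, 1 ≤ n → n ≤ g → powerSum (frobRoots h) (N * n) = powerSum (frobRoots f) (N * n)) :
    (frobRoots h).map (· ^ N) = (frobRoots f).map (· ^ N) := by
  obtain ⟨hcA, hsA, hpA⟩ := map_pow_frobRoots_symmetric hq hh hdeg hFE N
  obtain ⟨hcB, hsB, hpB⟩ := map_pow_frobRoots_symmetric hq hf hdegf hFEf N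
  have hQ : ((q : ℂ) ^ N) ≠ 0 := pow_ne_zero _ (by exact_mod_cast hq.ne')
  exact eq_of_powerSum_eq_of_map_div hQ hcA hcB hsA hsB hpA hpB fun n hn1 hng => by
    rw [powerSum_map_pow, powerSum_map_pow]; exact hs n hn1 hng

/-- `|a|` on `A` is read off `{a^N}` (`N ≥ 1`, constant modulus). [folklore] -/
private theorem norm_eq_of_map_pow_eq {A B : Multiset ℂ} {N : ℕ} (hN : N ≠ 0) {r : ℝ} (hr : 0 ≤ r)
    (hAB : A.map (· ^ N) = B.map (· ^ N)) (hB : ∀ b ∈ B, ‖b‖ = r) : ∀ a ∈ A, ‖a‖ = r := by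
  intro a ha
  have haN : a ^ N ∈ B.map (· ^ N) := hAB ▸ Multiset.mem_map_of_mem (· ^ N) ha
  obtain ⟨b, hb, hba⟩ := Multiset.mem_map.1 haN
  have h := congrArg norm hba
  rw [norm_pow, norm_pow, hB b hb] at h
  exact (pow_left_inj₀ (norm_nonneg a) hr hN).1 h.symm

/-- STRIDES DECIDE, INFORMATION FORM (FF-DOOR (i).G): two honest data of dimension `g` (`q, N ≥ 1`) with the same
traces at the lags `N, 2N, …, gN` — the same point counts over `𝔽_{q^N}, …, 𝔽_{q^{gN}}` — are RH-true TOGETHER.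
[folklore] -/
theorem ffRH_iff_of_strideTraces_eq {q : ℕ} (hq : 0 < q) {g N : ℕ} (hN : N ≠ 0) {h f : ℤ[X]}
    (hh : h.Monic) (hdeg : h.natDegree = 2 * g)
    (hFE : ∀ i j, i + j = 2 * g → (q : ℤ) ^ g * h.coeff j = (q : ℤ) ^ i * h.coeff i)
    (hf : f.Monic) (hdegf : f.natDegree = 2 * g)
    (hFEf : ∀ i j, i + j = 2 * g → (q : ℤ) ^ g * f.coeff j = (q : ℤ) ^ i * f.coeff i)
    (hs : ∀ n, 1 ≤ n → n ≤ g → powerSum (frobRoots h) (N * n) = powerSum (frobRoots f) (N * n)) :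
    (∀ α ∈ frobRoots h, ‖α‖ = Real.sqrt q) ↔ ∀ α ∈ frobRoots f, ‖α‖ = Real.sqrt q := by
  have heq := map_pow_frobRoots_eq_of_strideTraces_eq hq hh hdeg hFE hf hdegf hFEf hs
  exact ⟨norm_eq_of_map_pow_eq hN (Real.sqrt_nonneg _) heq.symm,
    norm_eq_of_map_pow_eq hN (Real.sqrt_nonneg _) heq⟩

/-- STRIDES DECIDE, READER FORM (FF-DOOR (i).G): for `q, N ≥ 1` and EVERY `g` there is a reader depending only on
the corner entries `T_{Nk}(0, Nk) = K(Nk)`, `k = 1, …, g` — the point counts over `𝔽_{q^N}, …, 𝔽_{q^{gN}}` — that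
DECIDES RH on the honest data of dimension `g` ("some RH-true honest datum of dimension `g` has these stride
traces").  `g` well-placed traces suffice, in infinitely many positions. [folklore] -/
theorem exists_strideTraceReader_deciding {q : ℕ} (hq : 0 < q) {N : ℕ} (hN : N ≠ 0) (g : ℕ) :
    ∃ Φ : Tower → Prop,
      (∀ T T' : Tower,
        (∀ k, 1 ≤ k → k ≤ g → T (N * k) 0 (Fin.last (N * k)) = T' (N * k) 0 (Fin.last (N * k))) → Φ T → Φ T') ∧
      ∀ h : ℤ[X], h.Monic → h.natDegree = 2 * g →
        (∀ i j, i + j = 2 * g → (q : ℤ) ^ g * h.coeff j = (q : ℤ) ^ i * h.coeff i) →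
        (Φ (weilWindowTower (q : ℝ) h) ↔ ∀ α ∈ frobRoots h, ‖α‖ = Real.sqrt q) := by
  have hq' : (0 : ℝ) < q := by exact_mod_cast hq
  refine ⟨fun T => ∃ f : ℤ[X], f.Monic ∧ f.natDegree = 2 * g ∧
      (∀ i j, i + j = 2 * g → (q : ℤ) ^ g * f.coeff j = (q : ℤ) ^ i * f.coeff i) ∧
      (∀ α ∈ frobRoots f, ‖α‖ = Real.sqrt q) ∧
      ∀ k, 1 ≤ k → k ≤ g →
        T (N * k) 0 (Fin.last (N * k)) = weilWindowTower (q : ℝ) f (N * k) 0 (Fin.last (N * k)), ?_, ?_⟩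
  · rintro T T' hTT' ⟨f, hf, hdegf, hFEf, hRf, htr⟩
    exact ⟨f, hf, hdegf, hFEf, hRf, fun k hk1 hkg => (hTT' k hk1 hkg).symm.trans (htr k hk1 hkg)⟩
  · intro h hh hdeg hFE
    constructor
    · rintro ⟨f, hf, hdegf, hFEf, hRf, htr⟩
      have hs : ∀ n, 1 ≤ n → n ≤ g → powerSum (frobRoots h) (N * n) = powerSum (frobRoots f) (N * n) :=
        fun n hn1 hng => (corner_eq_iff_powerSum_eq hq' h f (N * n)).1 (htr n hn1 hng)
      exact (ffRH_iff_of_strideTraces_eq hq hN hh hdeg hFE hf hdegf hFEf hs).2 hRf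
    · intro hR
      exact ⟨h, hh, hdeg, hFE, hR, fun k _ _ => rfl⟩

/-- FF-DOOR (i).G, EXACT PROGRESSION THRESHOLD: for `q ≥ 2`, `g ≥ 1`, `N ≥ 1` with `gcd(N, g) = 1`, a reader of the
traces at the lags `N, 2N, …, dN` deciding RH on the honest data of dimension `g` EXISTS IF AND ONLY IF `d ≥ g`
(⇐: `exists_strideTraceReader_deciding`; ⇒: for `d < g` the progression `N, …, dN` contains no multiple of `g`, so
part 7c's `traceReader_offMultiples_not_decides` applies).  `N = 1`: part 7b's threshold. [folklore] -/
theorem strideTraceReader_decides_iff {q : ℕ} (hq : 2 ≤ q) {g N d : ℕ} (hg : 1 ≤ g) (hN : N ≠ 0)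
    (hcop : Nat.Coprime N g) :
    (∃ Φ : Tower → Prop,
      (∀ T T' : Tower,
        (∀ k, 1 ≤ k → k ≤ d → T (N * k) 0 (Fin.last (N * k)) = T' (N * k) 0 (Fin.last (N * k))) → Φ T → Φ T') ∧
      ∀ h : ℤ[X], h.Monic → h.natDegree = 2 * g →
        (∀ i j, i + j = 2 * g → (q : ℤ) ^ g * h.coeff j = (q : ℤ) ^ i * h.coeff i) →
        (Φ (weilWindowTower (q : ℝ) h) ↔ ∀ α ∈ frobRoots h, ‖α‖ = Real.sqrt q)) ↔ g ≤ d := by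
  constructor
  · rintro ⟨Φ, hloc, hdec⟩
    by_contra hdg
    rw [not_le] at hdg
    refine traceReader_offMultiples_not_decides hq (F := {n | ∃ k, 1 ≤ k ∧ k ≤ d ∧ n = N * k}) (N := g)
      hg le_rfl (dvd_mul_left g 2) ?_ ⟨Φ, ?_, hdec⟩
    · rintro n ⟨k, hk1, hkd, rfl⟩ hgn
      exfalso
      have hgk : g ∣ k := (Nat.Coprime.symm hcop).dvd_of_dvd_mul_left hgn
      exact absurd (Nat.le_of_dvd (by omega) hgk) (by omega)
    · intro T T' hTT'
      exact hloc T T' fun k hk1 hkd => hTT' (N * k) ⟨k, hk1, hkd, rfl⟩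
  · intro hgd
    obtain ⟨Φ, hloc, hdec⟩ := exists_strideTraceReader_deciding (show 0 < q by omega) hN g
    exact ⟨Φ, fun T T' hTT' => hloc T T' fun k hk1 hkg => hTT' k hk1 (hkg.trans hgd), hdec⟩

/-! ## 4. Strides decide but do not pin -/

/-- The quadratic `x^2 + b x + q` (`b ∈ ℤ`) is an honest datum of dimension `1` with `s_2 = b^2 - 2q`. [folklore] -/
theorem honestQuadratic_powerSum_two (b : ℤ) (q : ℕ) :
    ((C 1 * X ^ 2 + C b * X + C (q : ℤ) : ℤ[X]).Monic ∧
      (C 1 * X ^ 2 + C b * X + C (q : ℤ) : ℤ[X]).natDegree = 2 * 1 ∧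
      ∀ i j, i + j = 2 * 1 → (q : ℤ) ^ 1 * (C 1 * X ^ 2 + C b * X + C (q : ℤ) : ℤ[X]).coeff j =
        (q : ℤ) ^ i * (C 1 * X ^ 2 + C b * X + C (q : ℤ) : ℤ[X]).coeff i) ∧
    powerSum (frobRoots (C 1 * X ^ 2 + C b * X + C (q : ℤ) : ℤ[X])) 2 = (b : ℂ) ^ 2 - 2 * (q : ℂ) := by
  set h : ℤ[X] := C 1 * X ^ 2 + C b * X + C (q : ℤ) with hdef
  have hdeg : h.natDegree = 2 := natDegree_quadratic one_ne_zero
  have hmon : h.Monic := by rw [Monic, hdef, leadingCoeff_quadratic one_ne_zero]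
  have hc : ∀ n, h.coeff n = (if n = 2 then 1 else 0) + b * (if 1 = n then 1 else 0) + if n = 0 then (q : ℤ) else 0 :=
    fun n => by simp only [hdef, coeff_add, coeff_C_mul, coeff_X_pow, coeff_X, coeff_C, one_mul]
  have hc0 : h.coeff 0 = q := by rw [hc]; norm_num
  have hc1 : h.coeff 1 = b := by rw [hc]; norm_num
  have hc2 : h.coeff 2 = 1 := by rw [hc]; norm_num
  have hFE : ∀ i j, i + j = 2 * 1 → (q : ℤ) ^ 1 * h.coeff j = (q : ℤ) ^ i * h.coeff i := by
    intro i j hij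
    have hi : i ≤ 2 := by omega
    obtain rfl : j = 2 - i := by omega
    interval_cases i
    · rw [show (2 : ℕ) - 0 = 2 from rfl, hc2, hc0]; ring
    · rfl
    · rw [show (2 : ℕ) - 2 = 0 from rfl, hc0, hc2]; ring
  refine ⟨⟨hmon, hdeg, hFE⟩, ?_⟩
  have h1 := powerSum_frobRoots_newton hmon (n := 1) le_rfl (by rw [hdeg]; norm_num)
  have h2 := powerSum_frobRoots_newton hmon (n := 2) (by norm_num) (by rw [hdeg])
  rw [hdeg] at h1 h2
  rw [show ((antidiagonal 1).filter (fun a : ℕ × ℕ => 0 < a.1 ∧ 0 < a.2)) = ∅ from by decide, sum_empty] at h1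
  rw [show ((antidiagonal 2).filter (fun a : ℕ × ℕ => 0 < a.1 ∧ 0 < a.2)) = {(1, 1)} from by decide,
    sum_singleton] at h2
  norm_num at h1 h2
  rw [h2, h1, hc1, hc0]
  push_cast
  ring

/-- STRIDES DECIDE BUT DO NOT PIN (contrast with part 7b, where `{1, …, g}` decides BY pinning the datum):
`x^2 + x + q` and `x^2 - x + q` are DISTINCT honest data of dimension `1` with the same trace at lag `2`
(`s_2 = 1 - 2q`), i.e. the same base-changed datum `{α^2}`; the `{2}`-reader of §3 (`N = 2`, `g = 1`) decides RH at
dimension `1` without telling them apart. [folklore] -/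
theorem strideTraces_not_pin (q : ℕ) :
    (C 1 * X ^ 2 + C 1 * X + C (q : ℤ) : ℤ[X]) ≠ C 1 * X ^ 2 + C (-1) * X + C (q : ℤ) ∧
    powerSum (frobRoots (C 1 * X ^ 2 + C 1 * X + C (q : ℤ) : ℤ[X])) 2 =
      powerSum (frobRoots (C 1 * X ^ 2 + C (-1) * X + C (q : ℤ) : ℤ[X])) 2 := by
  refine ⟨fun e => ?_, ?_⟩
  · have h := congrArg (fun p : ℤ[X] => p.coeff 1) e
    simp only [coeff_add, coeff_C_mul, coeff_X_pow, coeff_X, coeff_C] at h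
    norm_num at h
  · rw [(honestQuadratic_powerSum_two 1 q).2, (honestQuadratic_powerSum_two (-1) q).2]
    push_cast
    ring

end Summit.RiemannHypothesis.RiemannHypothesis.Theorems.MotivicDoor.FunctionField

end
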